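import Literature.NumberTheory.LFunctions.SelbergArchimedeanIntegral
import HarnessLib

/-!
# The archimedean integral of Selberg's functions for long windows: Goldston–Gonek (2.3) for `0 < h ≤ √t`

Topic `Literature/NumberTheory/LFunctions`. Everything in this file is PROVED (no definitions, no
named facts). RH-FREE analysis (nothing here bears on the truth of RH).

D. A. Goldston, S. M. Gonek, *A note on `S(t)` and the zeros of the Riemann zeta-function*,
Bull. LMS 39 (2007), eq. (2.3), as quoted by Balazard–de Roton, *Notes de lecture…*,
arXiv:0810.3587, Prop. 12: for `t ≥ 4`, `Δ ≥ 1`, `0 < h ≤ √t` and Selberg's functions `F±` of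
the interval `[−h, h]` with bandwidth `Δ`,

  `∫ F±(u − t) Re ψ(¼ + iu/2) du = (2h ± 1/Δ) log(t/2) + O(1)`.

The sibling file `SelbergArchimedeanIntegral.lean` proves the case `0 < h ≤ 1`; here the FULL
printed range `0 < h ≤ √t` is proved (for `t ≥ 36`, an absolute constant):
`Literature.NumberTheory.LFunctions.exists_abs_integral_selbergMajorant_reDigammaQuarter_sub_le_long`
and `…Minorant…`, together with the integrability of the archimedean integrands
(`integrable_selbergMajorant_shift_mul_reDigammaQuarter_long`, `…Minorant…`). This is the input
of the two-sided Prop. 15 of Balazard–de Roton on the full range `h ≤ √t`, i.e. of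
Goldston–Gonek's Theorem 1.

Proof (the printed "`O(1)`", made uniform in `h ≤ √t`). Write `w(u) = Re ψ(¼ + iu/2) − log(t/2)`
and split `|F±| ≤ 𝟙_{[−h,h]} + G±` with `G₊ = F₊ − 𝟙 ≥ 0`, `G₋ = 𝟙 − F₋ ≥ 0`, `∫ G± = 1/Δ ≤ 1`
(`SelbergMajorants.lean`). On the window `|u − t| ≤ h ≤ √t` one has `u ≥ t/2 ≥ 2` and the RATE
`|Re ψ(¼ + iu/2) − log(u/2)| ≤ 4/u` (from Gauss's bound
`|Re ψ(w) − log‖w‖| ≤ 1/(2‖w‖²) + π/(4|Im w|)`, `DigammaGauss.lean`), whence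
`|w(u)| ≤ 8/t + 2|u − t|/t ≤ (8 + 2h)/t` and the window contributes `≤ 2h(8 + 2h)/t ≤ 7`;
on `|u − t| < t/2` one has `|w(u)| ≤ 3`, so `G±` contributes `≤ 3/Δ ≤ 3` there; and on the far
range `|u − t| ≥ t/2 (≥ 2h + 2)` the decay `|F±(v)| ≤ 6/v²` and the `t`-free majorant
`|w(u)| ≤ C + 3√|u − t|` of the sibling file give the integrable majorant
`A((1 + |v|)√(1 + |v|))⁻¹` exactly as there.

## References

* [GoldstonGonek2007] D. A. Goldston, S. M. Gonek, Bull. LMS 39 (2007), 482–486, (2.3).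
* [BalazardDeRoton2008] M. Balazard, A. de Roton, arXiv:0810.3587, Prop. 12.
  [cite: BalazardDeRoton2008, Prop. 12]
-/

noncomputable section

open Complex Filter Set MeasureTheory Topology
open scoped Real

namespace Literature.NumberTheory.LFunctions

open Literature.Analysis.Fourier Literature.Analysis.SpecialFunctions

namespace ArchimedeanLong

/-! ## The rate `|Re ψ(¼ + iu/2) − log(u/2)| ≤ 4/u` for `u ≥ 2` -/

/-- **Stirling with a rate on the line `Re s = ¼`**: `|Re ψ(¼ + iu/2) − log(u/2)| ≤ 4/u` for
`u ≥ 2` (from Gauss's bound `|Re ψ(w) − log‖w‖| ≤ 1/(2‖w‖²) + π/(4|Im w|)` and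
`u/2 ≤ ‖¼ + iu/2‖ ≤ ¼ + u/2`). [folklore] -/
private theorem abs_reDigammaQuarter_sub_log_le {u : ℝ} (hu : 2 ≤ u) :
    |reDigammaQuarter u - Real.log (u / 2)| ≤ 4 / u := by
  set w : ℂ := 1 / 4 + (u : ℂ) / 2 * I with hw
  have hwre : w.re = 1 / 4 := by simp [hw]
  have hwim : w.im = u / 2 := by simp [hw]
  have hu0 : 0 < u := by linarith
  have hre : 0 < w.re := by rw [hwre]; norm_num
  have him : w.im ≠ 0 := by rw [hwim]; positivity
  have hgauss := Literature.Analysis.SpecialFunctions.Complex.abs_re_digamma_sub_log_norm_le hre him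
  have hψ : reDigammaQuarter u = (Complex.digamma w).re := by
    simp only [reDigammaQuarter, hw]
  -- `u/2 ≤ ‖w‖ ≤ 1/4 + u/2`
  have hnorm_ge : u / 2 ≤ ‖w‖ := by
    have := Complex.abs_im_le_norm w
    rw [hwim, abs_of_pos (by positivity)] at this
    exact this
  have hnorm_le : ‖w‖ ≤ 1 / 4 + u / 2 := by
    have := Complex.norm_le_abs_re_add_abs_im w
    rw [hwre, hwim, abs_of_pos (by norm_num : (0:ℝ) < 1 / 4), abs_of_pos (by positivity)] at this
    exact this
  have hnorm_pos : 0 < ‖w‖ := lt_of_lt_of_le (by positivity) hnorm_ge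
  -- the Gauss error `≤ 2/u² + π/(2u) ≤ 1/u + 1.6/u`
  have hg1 : 1 / (2 * ‖w‖ ^ 2) ≤ 1 / u := by
    rw [div_le_div_iff₀ (by positivity) hu0]
    nlinarith
  have hg2 : π / (4 * |w.im|) ≤ 1.6 / u := by
    rw [hwim, abs_of_pos (by positivity), div_le_div_iff₀ (by positivity) hu0]
    nlinarith [Real.pi_lt_d2]
  -- `0 ≤ log‖w‖ − log(u/2) ≤ 1/(2u)`
  have hl1 : 0 ≤ Real.log ‖w‖ - Real.log (u / 2) := by
    rw [sub_nonneg]; exact Real.log_le_log (by positivity) hnorm_ge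
  have hl2 : Real.log ‖w‖ - Real.log (u / 2) ≤ 1 / (2 * u) := by
    rw [← Real.log_div hnorm_pos.ne' (by positivity)]
    have hq : ‖w‖ / (u / 2) ≤ 1 + 1 / (2 * u) := by
      rw [div_le_iff₀ (by positivity)]
      have : (1 + 1 / (2 * u)) * (u / 2) = 1 / 4 + u / 2 := by field_simp; ring
      rw [this]; exact hnorm_le
    have hqpos : 0 < ‖w‖ / (u / 2) := by positivity
    calc Real.log (‖w‖ / (u / 2)) ≤ ‖w‖ / (u / 2) - 1 := Real.log_le_sub_one_of_pos hqpos
      _ ≤ 1 / (2 * u) := by linarith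
  have hl3 : 1 / (2 * u) ≤ 0.5 / u := by
    rw [div_le_div_iff₀ (by positivity) hu0]; nlinarith
  rw [hψ]
  calc |(Complex.digamma w).re - Real.log (u / 2)|
      = |((Complex.digamma w).re - Real.log ‖w‖) + (Real.log ‖w‖ - Real.log (u / 2))| := by ring_nf
    _ ≤ |(Complex.digamma w).re - Real.log ‖w‖| + |Real.log ‖w‖ - Real.log (u / 2)| := abs_add_le _ _
    _ ≤ (1 / (2 * ‖w‖ ^ 2) + π / (4 * |w.im|)) + 1 / (2 * u) := by
        rw [abs_of_nonneg hl1]; exact add_le_add hgauss hl2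
    _ ≤ (1 / u + 1.6 / u) + 0.5 / u := by gcongr
    _ = 3.1 / u := by ring
    _ ≤ 4 / u := by gcongr; norm_num

/-- `|log x| ≤ 2|x − 1|` for `x ≥ 1/2`. [folklore] -/
private theorem abs_log_le_two_mul_abs_sub_one {x : ℝ} (hx : 1 / 2 ≤ x) : |Real.log x| ≤ 2 * |x - 1| := by
  have hx0 : 0 < x := by linarith
  rw [abs_le]
  constructor
  · -- `log x ≥ 1 − 1/x ≥ −2|x−1|`
    have h1 := Real.one_sub_inv_le_log_of_pos hx0
    have h2 : -(2 * |x - 1|) ≤ 1 - x⁻¹ := by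
      rcases le_or_gt 1 x with hx1 | hx1
      · rw [abs_of_nonneg (by linarith)]
        have : x⁻¹ ≤ 1 := inv_le_one_of_one_le₀ hx1
        nlinarith
      · rw [abs_of_neg (by linarith)]
        have hinv : x⁻¹ ≤ 2 := by
          rw [inv_le_comm₀ hx0 (by norm_num)]; linarith
        -- `1 − 1/x = (x−1)/x ≥ (x − 1)·2` since `x − 1 < 0` and `1/x ≤ 2`
        have : 1 - x⁻¹ = (x - 1) * x⁻¹ := by field_simp
        rw [this]
        nlinarith [inv_pos.2 hx0]
    linarith
  · have h1 := Real.log_le_sub_one_of_pos hx0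
    linarith [le_abs_self (x - 1), abs_nonneg (x - 1)]

/-- On the window `|u − t| ≤ h` with `h ≤ √t`, `t ≥ 36`:
`|Re ψ(¼ + iu/2) − log(t/2)| ≤ (8 + 2h)/t`. [cite: BalazardDeRoton2008, Prop. 12 (proof)] -/
theorem abs_sub_log_half_le_window {t h u : ℝ} (ht : 36 ≤ t) (hh : h ≤ Real.sqrt t)
    (hu : |u - t| ≤ h) : |reDigammaQuarter u - Real.log (t / 2)| ≤ (8 + 2 * h) / t := by
  have ht0 : 0 < t := by linarith
  have hst : Real.sqrt t ≤ t / 4 := by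
    rw [Real.sqrt_le_left (by positivity)]; nlinarith
  have hh' : h ≤ t / 4 := hh.trans hst
  have hut : |u - t| ≤ t / 4 := hu.trans hh'
  have hu1 : t / 2 ≤ u := by have := (abs_le.1 hut).1; linarith
  have hu2 : 2 ≤ u := by linarith
  have hu0 : 0 < u := by linarith
  have hrate := abs_reDigammaQuarter_sub_log_le hu2
  -- `4/u ≤ 8/t`
  have h1 : 4 / u ≤ 8 / t := by
    rw [div_le_div_iff₀ hu0 ht0]; linarith
  -- `|log(u/2) − log(t/2)| = |log(u/t)| ≤ 2|u/t − 1| = 2|u − t|/t ≤ 2h/t`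
  have h2 : |Real.log (u / 2) - Real.log (t / 2)| ≤ 2 * h / t := by
    rw [← Real.log_div (by positivity) (by positivity)]
    have hq : u / 2 / (t / 2) = u / t := by field_simp
    rw [hq]
    have hx : 1 / 2 ≤ u / t := by rw [le_div_iff₀ ht0]; linarith
    refine (abs_log_le_two_mul_abs_sub_one hx).trans ?_
    have : u / t - 1 = (u - t) / t := by field_simp
    rw [this, abs_div, abs_of_pos ht0, ← mul_div_assoc, div_le_div_iff_of_pos_right ht0]
    linarith
  calc |reDigammaQuarter u - Real.log (t / 2)|
      = |(reDigammaQuarter u - Real.log (u / 2)) + (Real.log (u / 2) - Real.log (t / 2))| := by ring_nf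
    _ ≤ |reDigammaQuarter u - Real.log (u / 2)| + |Real.log (u / 2) - Real.log (t / 2)| := abs_add_le _ _
    _ ≤ 8 / t + 2 * h / t := add_le_add (hrate.trans h1) h2
    _ = (8 + 2 * h) / t := by ring

/-- On the near range `|u − t| < t/2` (`t ≥ 4`): `|Re ψ(¼ + iu/2) − log(t/2)| ≤ 3`.
[cite: BalazardDeRoton2008, Prop. 12 (proof)] -/
theorem abs_sub_log_half_le_near {t u : ℝ} (ht : 4 ≤ t) (hu : |u - t| < t / 2) :
    |reDigammaQuarter u - Real.log (t / 2)| ≤ 3 := by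
  have ht0 : 0 < t := by linarith
  obtain ⟨hl, hr⟩ := abs_lt.1 hu
  have hu1 : t / 2 < u := by linarith
  have hu2 : 2 ≤ u := by linarith
  have hu0 : 0 < u := by linarith
  have hrate := abs_reDigammaQuarter_sub_log_le hu2
  have h1 : 4 / u ≤ 2 := by rw [div_le_iff₀ hu0]; linarith
  have h2 : |Real.log (u / 2) - Real.log (t / 2)| ≤ 1 := by
    rw [← Real.log_div (by positivity) (by positivity)]
    have hq : u / 2 / (t / 2) = u / t := by field_simp
    rw [hq]
    have hx : 1 / 2 ≤ u / t := by rw [le_div_iff₀ ht0]; linarith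
    refine (abs_log_le_two_mul_abs_sub_one hx).trans ?_
    have hx1 : u / t - 1 < 1 / 2 := by rw [div_sub_one ht0.ne', div_lt_iff₀ ht0]; linarith
    have hx2 : -(1 / 2) ≤ u / t - 1 := by linarith
    have : |u / t - 1| ≤ 1 / 2 := abs_le.2 ⟨hx2, hx1.le⟩
    linarith
  calc |reDigammaQuarter u - Real.log (t / 2)|
      = |(reDigammaQuarter u - Real.log (u / 2)) + (Real.log (u / 2) - Real.log (t / 2))| := by ring_nf
    _ ≤ |reDigammaQuarter u - Real.log (u / 2)| + |Real.log (u / 2) - Real.log (t / 2)| := abs_add_le _ _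
    _ ≤ 2 + 1 := add_le_add (hrate.trans h1) h2
    _ = 3 := by norm_num

/-! ## Far-field decay of `F±` on `ℝ` for an arbitrary window `[−h, h]` -/

/-- Far-field on `ℝ` for `[−h, h]`, `Δ ≥ 1`: `|F₊(v)| ≤ 6/v²` for `|v| ≥ 2h + 2`.
[cite: BalazardDeRoton2008, Prop. 10 (iv)] -/
theorem abs_selbergMajorantReal_le_far {Δ h : ℝ} (hΔ : 1 ≤ Δ) (hh0 : 0 < h) {v : ℝ}
    (hv : 2 * h + 2 ≤ |v|) : |selbergMajorantReal Δ (-h) h v| ≤ 6 / v ^ 2 := by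
  have hΔ0 : 0 < Δ := by linarith
  have hmax : max (-h) h = h := max_eq_right (by linarith)
  have hmin : min (-h) h = -h := min_eq_left (by linarith)
  have h1Δ : 1 / Δ ≤ 1 := by rw [div_le_one hΔ0]; exact hΔ
  have hvne : v ≠ 0 := by intro h0; rw [h0, abs_zero] at hv; linarith
  have hv2pos : 0 < v ^ 2 := lt_of_le_of_ne (sq_nonneg v) (Ne.symm (pow_ne_zero 2 hvne))
  have key : ∀ d : ℝ, |v| - h ≤ d →
      3 / 2 * Real.exp (2 * π * Δ * |(0 : ℝ)|) / (Δ ^ 2 * d ^ 2) ≤ 6 / v ^ 2 := by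
    intro d hd
    have hdpos : 0 < d := by linarith [abs_nonneg v]
    simp only [abs_zero, mul_zero, Real.exp_zero, mul_one]
    rw [div_le_div_iff₀ (by positivity) hv2pos]
    have hd2 : |v| ≤ 2 * d := by linarith
    have h3 : v ^ 2 ≤ 4 * d ^ 2 := by nlinarith [sq_abs v, abs_nonneg v]
    have h4 : 1 ≤ Δ ^ 2 := by nlinarith
    nlinarith [sq_nonneg d]
  rcases le_or_gt 0 v with hv' | hv'
  · rw [abs_of_nonneg hv'] at hv key
    have hz : max (-h) h + 1 / Δ ≤ ((v : ℂ)).re := by rw [hmax, Complex.ofReal_re]; linarith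
    have hb := norm_selbergMajorant_le_of_le_re (a := -h) (b := h) hΔ0 hz
    rw [selbergMajorant_ofReal, Complex.norm_real, Real.norm_eq_abs, hmax, Complex.ofReal_im,
      Complex.ofReal_re] at hb
    exact hb.trans (key (v - h) le_rfl)
  · rw [abs_of_neg hv'] at hv key
    have hz : ((v : ℂ)).re ≤ min (-h) h - 1 / Δ := by rw [hmin, Complex.ofReal_re]; linarith
    have hb := norm_selbergMajorant_le_of_re_le (a := -h) (b := h) hΔ0 hz
    rw [selbergMajorant_ofReal, Complex.norm_real, Real.norm_eq_abs, hmin, Complex.ofReal_im,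
      Complex.ofReal_re] at hb
    exact hb.trans (key (-h - v) (by linarith))

/-- Far-field on `ℝ` for `[−h, h]`, `Δ ≥ 1`: `|F₋(v)| ≤ 6/v²` for `|v| ≥ 2h + 2`.
[cite: BalazardDeRoton2008, Prop. 10 (iv)] -/
theorem abs_selbergMinorantReal_le_far {Δ h : ℝ} (hΔ : 1 ≤ Δ) (hh0 : 0 < h) {v : ℝ}
    (hv : 2 * h + 2 ≤ |v|) : |selbergMinorantReal Δ (-h) h v| ≤ 6 / v ^ 2 := by
  rw [selbergMinorantReal_eq_neg_selbergMajorantReal, abs_neg]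
  have hΔ0 : 0 < Δ := by linarith
  have hmax : max h (-h) = h := max_eq_left (by linarith)
  have hmin : min h (-h) = -h := min_eq_right (by linarith)
  have h1Δ : 1 / Δ ≤ 1 := by rw [div_le_one hΔ0]; exact hΔ
  have hvne : v ≠ 0 := by intro h0; rw [h0, abs_zero] at hv; linarith
  have hv2pos : 0 < v ^ 2 := lt_of_le_of_ne (sq_nonneg v) (Ne.symm (pow_ne_zero 2 hvne))
  have key : ∀ d : ℝ, |v| - h ≤ d →
      3 / 2 * Real.exp (2 * π * Δ * |(0 : ℝ)|) / (Δ ^ 2 * d ^ 2) ≤ 6 / v ^ 2 := by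
    intro d hd
    have hdpos : 0 < d := by linarith [abs_nonneg v]
    simp only [abs_zero, mul_zero, Real.exp_zero, mul_one]
    rw [div_le_div_iff₀ (by positivity) hv2pos]
    have hd2 : |v| ≤ 2 * d := by linarith
    have h3 : v ^ 2 ≤ 4 * d ^ 2 := by nlinarith [sq_abs v, abs_nonneg v]
    have h4 : 1 ≤ Δ ^ 2 := by nlinarith
    nlinarith [sq_nonneg d]
  rcases le_or_gt 0 v with hv' | hv'
  · rw [abs_of_nonneg hv'] at hv key
    have hz : max h (-h) + 1 / Δ ≤ ((v : ℂ)).re := by rw [hmax, Complex.ofReal_re]; linarith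
    have hb := norm_selbergMajorant_le_of_le_re (a := h) (b := -h) hΔ0 hz
    rw [selbergMajorant_ofReal, Complex.norm_real, Real.norm_eq_abs, hmax, Complex.ofReal_im,
      Complex.ofReal_re] at hb
    exact hb.trans (key (v - h) le_rfl)
  · rw [abs_of_neg hv'] at hv key
    have hz : ((v : ℂ)).re ≤ min h (-h) - 1 / Δ := by rw [hmin, Complex.ofReal_re]; linarith
    have hb := norm_selbergMajorant_le_of_re_le (a := h) (b := -h) hΔ0 hz
    rw [selbergMajorant_ofReal, Complex.norm_real, Real.norm_eq_abs, hmin, Complex.ofReal_im,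
      Complex.ofReal_re] at hb
    exact hb.trans (key (-h - v) (by linarith))

/-! ## The core estimate, uniform in `0 < h ≤ √t` -/

/-- **Core of Goldston–Gonek (2.3) on the full range.** Let `F : ℝ → ℝ` be continuous and
integrable with `|F| ≤ C₀`, `|F| ≤ 𝟙_{[−h,h]} + G` with `G ≥ 0`, `∫ G ≤ 1`, and `|F(v)| ≤ 6/v²`
for `|v| ≥ t/2`, where `t ≥ 36` and `0 < h ≤ √t`. Then `u ↦ F(u − t) Re ψ(¼ + iu/2)` is
integrable and `|∫ F(u − t) Re ψ(¼ + iu/2) du − (∫ F) log(t/2)| ≤ 10 + A(C₀) I₀` with the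
constants of `SelbergArchimedeanIntegral.lean`. [cite: BalazardDeRoton2008, Prop. 12] -/
theorem core {C C₀ : ℝ} (hC : 0 ≤ C) (hC₀ : 0 ≤ C₀)
    (hdig : ∀ t : ℝ, 4 ≤ t → ∀ u : ℝ, |reDigammaQuarter u - Real.log (t / 2)| ≤ C + 3 * Real.sqrt |u - t|)
    {F G : ℝ → ℝ} (hFc : Continuous F) (hFi : Integrable F) (hF : ∀ v, |F v| ≤ C₀)
    {t h : ℝ} (ht : 36 ≤ t) (hh0 : 0 < h) (hh : h ≤ Real.sqrt t)
    (hFG : ∀ v, |F v| ≤ (Icc (-h) h).indicator (fun _ ↦ (1 : ℝ)) v + G v)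
    (hG0 : ∀ v, 0 ≤ G v) (hGi : Integrable G) (hGint : ∫ v, G v ≤ 1)
    (hfar : ∀ v, t / 2 ≤ |v| → |F v| ≤ 6 / v ^ 2) :
    Integrable (fun u : ℝ ↦ F (u - t) * reDigammaQuarter u) ∧
    |(∫ u : ℝ, F (u - t) * reDigammaQuarter u) - (∫ v, F v) * Real.log (t / 2)| ≤
      10 + (6 * C₀ * (C + 5) + 12 * (C + 9)) * ∫ v : ℝ, ((1 + |v|) * Real.sqrt (1 + |v|))⁻¹ := by
  have ht4 : 4 ≤ t := by linarith
  have ht0 : 0 < t := by linarith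
  have hab : -h ≤ h := by linarith
  set A : ℝ := 6 * C₀ * (C + 5) + 12 * (C + 9) with hA
  have hA0 : 0 ≤ A := by positivity
  set K : ℝ := (8 + 2 * h) / t with hK
  have hK0 : 0 ≤ K := by positivity
  set w : ℝ → ℝ := fun u ↦ reDigammaQuarter u - Real.log (t / 2) with hw
  set ind : ℝ → ℝ := fun v ↦ (Icc (-h) h).indicator (fun _ ↦ (1 : ℝ)) v with hind
  set φ : ℝ → ℝ := fun v ↦ ((1 + |v|) * Real.sqrt (1 + |v|))⁻¹ with hφ
  have hφ0 : ∀ v, 0 ≤ φ v := fun v ↦ by positivity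
  have hind0 : ∀ v, 0 ≤ ind v := fun v ↦ Set.indicator_nonneg (fun _ _ ↦ zero_le_one) v
  set m : ℝ → ℝ := fun v ↦ K * ind v + 3 * G v + A * φ v with hm
  -- the pointwise majorant
  have hmaj : ∀ u : ℝ, ‖F (u - t) * w u‖ ≤ m (u - t) := by
    intro u
    rw [Real.norm_eq_abs, abs_mul]
    have hi0 := hind0 (u - t)
    have hg0 := hG0 (u - t)
    have hp0 := hφ0 (u - t)
    rcases le_or_gt (t / 2) |u - t| with hfar' | hnear
    · -- far range
      have h1 : |F (u - t)| * |w u| ≤ |F (u - t)| * (C + 3 * Real.sqrt |u - t|) := by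
        gcongr; exact hdig t ht4 u
      have h2 := majorant_pointwise (v := u - t) hC hC₀ (hF (u - t)) (fun _ ↦ hfar (u - t) hfar')
      calc |F (u - t)| * |w u| ≤ A * φ (u - t) := h1.trans h2
        _ ≤ m (u - t) := by simp only [hm]; nlinarith
    · -- near range
      have hw3 : |w u| ≤ 3 := abs_sub_log_half_le_near ht4 hnear
      have hsplit : |F (u - t)| * |w u| ≤ ind (u - t) * |w u| + G (u - t) * |w u| := by
        have := hFG (u - t)
        calc |F (u - t)| * |w u| ≤ (ind (u - t) + G (u - t)) * |w u| := by gcongr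
          _ = ind (u - t) * |w u| + G (u - t) * |w u| := by ring
      have hI : ind (u - t) * |w u| ≤ K * ind (u - t) := by
        by_cases hv : u - t ∈ Icc (-h) h
        · have hwin : |u - t| ≤ h := abs_le.2 ⟨hv.1, hv.2⟩
          have hwK : |w u| ≤ K := abs_sub_log_half_le_window ht hh hwin
          have h1 : ind (u - t) = 1 := by simp only [hind, Set.indicator_of_mem hv]
          rw [h1]; linarith
        · have h1 : ind (u - t) = 0 := by simp only [hind, Set.indicator_of_notMem hv]
          rw [h1]; simp
      have hG : G (u - t) * |w u| ≤ 3 * G (u - t) := by nlinarith [abs_nonneg (w u)]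
      calc |F (u - t)| * |w u| ≤ K * ind (u - t) + 3 * G (u - t) := by linarith
        _ ≤ m (u - t) := by simp only [hm]; nlinarith
  -- integrability of the majorant and of the integrand
  have hind_int : Integrable ind := integrable_indicator_Icc (-h) h
  have hφ_int : Integrable φ := integrable_inv_one_add_abs_mul_sqrt
  have hm_int : Integrable m :=
    ((hind_int.const_mul K).add (hGi.const_mul 3)).add (hφ_int.const_mul A)
  have hm_int' : Integrable fun u : ℝ ↦ m (u - t) := hm_int.comp_sub_right t
  have hcontw : Continuous w := continuous_reDigammaQuarter.sub continuous_const
  have hint1 : Integrable fun u : ℝ ↦ F (u - t) * w u :=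
    Integrable.mono' hm_int' ((hFc.comp (continuous_id.sub continuous_const)).mul hcontw).aestronglyMeasurable
      (Eventually.of_forall hmaj)
  have hint2 : Integrable fun u : ℝ ↦ F (u - t) := hFi.comp_sub_right t
  have hintegrable : Integrable (fun u : ℝ ↦ F (u - t) * reDigammaQuarter u) := by
    have h := hint1.add (hint2.mul_const (Real.log (t / 2)))
    refine h.congr (Eventually.of_forall fun u ↦ ?_)
    simp only [hw, Pi.add_apply]
    ring
  refine ⟨hintegrable, ?_⟩
  -- decomposition `F(u−t) ρ(u) = F(u−t) w(u) + log(t/2) F(u−t)`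
  have hdec : ∫ u : ℝ, F (u - t) * reDigammaQuarter u =
      (∫ u : ℝ, F (u - t) * w u) + Real.log (t / 2) * ∫ u : ℝ, F (u - t) := by
    rw [← MeasureTheory.integral_const_mul, ← integral_add hint1 (hint2.const_mul _)]
    refine integral_congr_ae (Eventually.of_forall fun u ↦ ?_)
    simp only [hw]; ring
  have hshift : ∫ u : ℝ, F (u - t) = ∫ v, F v := integral_sub_right_eq_self F t
  have hkey : (∫ u : ℝ, F (u - t) * reDigammaQuarter u) - (∫ v, F v) * Real.log (t / 2) =
      ∫ u : ℝ, F (u - t) * w u := by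
    simp only [hdec, hshift]
    ring
  rw [hkey]
  -- the integral of the majorant
  have hm_integral : ∫ v, m v = K * (2 * h) + 3 * (∫ v, G v) + A * (∫ v, φ v) := by
    have h1 : ∫ v, m v = (∫ v, (K * ind v + 3 * G v)) + ∫ v, A * φ v :=
      integral_add ((hind_int.const_mul K).add (hGi.const_mul 3)) (hφ_int.const_mul A)
    have h2 : ∫ v, (K * ind v + 3 * G v) = (∫ v, K * ind v) + ∫ v, 3 * G v :=
      integral_add (hind_int.const_mul K) (hGi.const_mul 3)
    rw [h1, h2, MeasureTheory.integral_const_mul, MeasureTheory.integral_const_mul,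
      MeasureTheory.integral_const_mul]
    have h3 : ∫ v, ind v = 2 * h := by
      simp only [hind]
      rw [integral_indicator_Icc hab]; ring
    rw [h3]
  have hKh : K * (2 * h) ≤ 7 := by
    -- `2h(8 + 2h) ≤ 16√t + 4t ≤ 8t/3 + 4t ≤ 7t`
    have hsq : h ^ 2 ≤ t := by
      have h1 : h ^ 2 ≤ Real.sqrt t ^ 2 := by gcongr
      rw [Real.sq_sqrt ht0.le] at h1
      exact h1
    have hst : Real.sqrt t ≤ t / 6 := by
      rw [Real.sqrt_le_left (by positivity)]; nlinarith
    have hh6 : h ≤ t / 6 := hh.trans hst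
    rw [hK, div_mul_eq_mul_div, div_le_iff₀ ht0]
    nlinarith
  calc |∫ u : ℝ, F (u - t) * w u| = ‖∫ u : ℝ, F (u - t) * w u‖ := (Real.norm_eq_abs _).symm
    _ ≤ ∫ u : ℝ, m (u - t) := norm_integral_le_of_norm_le hm_int' (Eventually.of_forall hmaj)
    _ = ∫ v, m v := integral_sub_right_eq_self m t
    _ = K * (2 * h) + 3 * (∫ v, G v) + A * (∫ v, φ v) := hm_integral
    _ ≤ 7 + 3 * 1 + A * (∫ v, φ v) := by gcongr
    _ = 10 + A * ∫ v : ℝ, ((1 + |v|) * Real.sqrt (1 + |v|))⁻¹ := by simp only [hφ]; ring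

end ArchimedeanLong

open ArchimedeanLong

/-! ## Goldston–Gonek (2.3) for `0 < h ≤ √t` -/

/-- `√t ≤ t/6` for `t ≥ 36`. [folklore] -/
private theorem sqrt_le_div_six {t : ℝ} (ht : 36 ≤ t) : Real.sqrt t ≤ t / 6 := by
  rw [Real.sqrt_le_left (by positivity)]; nlinarith

/-- The archimedean integrand of `F₊(· − t)` is integrable (`Δ ≥ 1`, `t ≥ 36`, `0 < h ≤ √t`).
[cite: BalazardDeRoton2008, Prop. 12] -/
theorem integrable_selbergMajorant_shift_mul_reDigammaQuarter_long {Δ t h : ℝ} (hΔ : 1 ≤ Δ)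
    (ht : 36 ≤ t) (hh0 : 0 < h) (hh : h ≤ Real.sqrt t) :
    Integrable fun u : ℝ ↦ selbergMajorantReal Δ (-h) h (u - t) * reDigammaQuarter u := by
  obtain ⟨C, hC, hdig⟩ := exists_abs_reDigammaQuarter_sub_log_half_le
  have hΔ0 : 0 < Δ := by linarith
  have hab : -h ≤ h := by linarith
  have hst := sqrt_le_div_six ht
  refine (core (G := fun v ↦ selbergMajorantReal Δ (-h) h v - (Icc (-h) h).indicator (fun _ ↦ (1 : ℝ)) v)
    hC (by positivity : (0 : ℝ) ≤ 3 * Real.exp (2 * π)) hdig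
    (continuous_selbergMajorantReal Δ (-h) h) (integrable_selbergMajorantReal hΔ0 hab)
    (fun v ↦ abs_selbergMajorantReal_le hΔ0 _ _ v) ht hh0 hh ?_ ?_
    (integrable_selbergMajorantReal_sub_indicator hΔ0 hab) ?_ ?_).1
  · intro v
    rw [abs_of_nonneg (selbergMajorantReal_nonneg hΔ0 hab v)]
    linarith
  · intro v
    have := indicator_le_selbergMajorantReal hΔ0 hab v
    linarith
  · rw [integral_selbergMajorantReal_sub_indicator hΔ0 hab, div_le_one hΔ0]; exact hΔ
  · intro v hv
    exact abs_selbergMajorantReal_le_far hΔ hh0 (by linarith [hh.trans hst])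

/-- The archimedean integrand of `F₋(· − t)` is integrable (`Δ ≥ 1`, `t ≥ 36`, `0 < h ≤ √t`).
[cite: BalazardDeRoton2008, Prop. 12] -/
theorem integrable_selbergMinorant_shift_mul_reDigammaQuarter_long {Δ t h : ℝ} (hΔ : 1 ≤ Δ)
    (ht : 36 ≤ t) (hh0 : 0 < h) (hh : h ≤ Real.sqrt t) :
    Integrable fun u : ℝ ↦ selbergMinorantReal Δ (-h) h (u - t) * reDigammaQuarter u := by
  obtain ⟨C, hC, hdig⟩ := exists_abs_reDigammaQuarter_sub_log_half_le
  have hΔ0 : 0 < Δ := by linarith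
  have hab : -h ≤ h := by linarith
  have hst := sqrt_le_div_six ht
  refine (core (G := fun v ↦ (Icc (-h) h).indicator (fun _ ↦ (1 : ℝ)) v - selbergMinorantReal Δ (-h) h v)
    hC (by positivity : (0 : ℝ) ≤ 3 * Real.exp (2 * π)) hdig
    (continuous_selbergMinorantReal Δ (-h) h) (integrable_selbergMinorantReal hΔ0 hab)
    (fun v ↦ abs_selbergMinorantReal_le hΔ0 _ _ v) ht hh0 hh ?_ ?_
    (integrable_indicator_sub_selbergMinorantReal hΔ0 hab) ?_ ?_).1
  · intro v
    have h1 := selbergMinorantReal_le_indicator_Icc hΔ0 (-h) h v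
    have h0 : 0 ≤ (Icc (-h) h).indicator (fun _ ↦ (1 : ℝ)) v :=
      Set.indicator_nonneg (fun _ _ ↦ zero_le_one) v
    rw [abs_le]; constructor <;> linarith
  · intro v
    have := selbergMinorantReal_le_indicator_Icc hΔ0 (-h) h v
    linarith
  · rw [integral_indicator_sub_selbergMinorantReal hΔ0 hab, div_le_one hΔ0]; exact hΔ
  · intro v hv
    exact abs_selbergMinorantReal_le_far hΔ hh0 (by linarith [hh.trans hst])

/-- **Goldston–Gonek (2.3), majorant, full range** (`Δ ≥ 1`, `t ≥ 36`, `0 < h ≤ √t`): with an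
absolute constant `C`, `|∫ F₊(u − t) Re ψ(¼ + iu/2) du − (2h + 1/Δ) log(t/2)| ≤ C`.
[cite: BalazardDeRoton2008, Prop. 12] -/
theorem exists_abs_integral_selbergMajorant_reDigammaQuarter_sub_le_long :
    ∃ C : ℝ, ∀ Δ t h : ℝ, 1 ≤ Δ → 36 ≤ t → 0 < h → h ≤ Real.sqrt t →
      |(∫ u : ℝ, selbergMajorantReal Δ (-h) h (u - t) * reDigammaQuarter u)
        - (2 * h + 1 / Δ) * Real.log (t / 2)| ≤ C := by
  obtain ⟨C, hC, hdig⟩ := exists_abs_reDigammaQuarter_sub_log_half_le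
  set C₀ : ℝ := 3 * Real.exp (2 * π) with hC₀
  refine ⟨10 + (6 * C₀ * (C + 5) + 12 * (C + 9)) * ∫ v : ℝ, ((1 + |v|) * Real.sqrt (1 + |v|))⁻¹,
    fun Δ t h hΔ ht hh0 hh ↦ ?_⟩
  have hΔ0 : 0 < Δ := by linarith
  have hab : -h ≤ h := by linarith
  have hst := sqrt_le_div_six ht
  have hint := integral_selbergMajorantReal hΔ0 hab
  have hm : (2 * h + 1 / Δ) = ∫ v, selbergMajorantReal Δ (-h) h v := by rw [hint]; ring
  rw [hm]
  refine (core (G := fun v ↦ selbergMajorantReal Δ (-h) h v - (Icc (-h) h).indicator (fun _ ↦ (1 : ℝ)) v)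
    hC (by positivity : (0 : ℝ) ≤ C₀) hdig
    (continuous_selbergMajorantReal Δ (-h) h) (integrable_selbergMajorantReal hΔ0 hab)
    (fun v ↦ abs_selbergMajorantReal_le hΔ0 _ _ v) ht hh0 hh ?_ ?_
    (integrable_selbergMajorantReal_sub_indicator hΔ0 hab) ?_ ?_).2
  · intro v
    rw [abs_of_nonneg (selbergMajorantReal_nonneg hΔ0 hab v)]
    linarith
  · intro v
    have := indicator_le_selbergMajorantReal hΔ0 hab v
    linarith
  · rw [integral_selbergMajorantReal_sub_indicator hΔ0 hab, div_le_one hΔ0]; exact hΔ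
  · intro v hv
    exact abs_selbergMajorantReal_le_far hΔ hh0 (by linarith [hh.trans hst])

/-- **Goldston–Gonek (2.3), minorant, full range** (`Δ ≥ 1`, `t ≥ 36`, `0 < h ≤ √t`):
`|∫ F₋(u − t) Re ψ(¼ + iu/2) du − (2h − 1/Δ) log(t/2)| ≤ C`. [cite: BalazardDeRoton2008, Prop. 12] -/
theorem exists_abs_integral_selbergMinorant_reDigammaQuarter_sub_le_long :
    ∃ C : ℝ, ∀ Δ t h : ℝ, 1 ≤ Δ → 36 ≤ t → 0 < h → h ≤ Real.sqrt t →
      |(∫ u : ℝ, selbergMinorantReal Δ (-h) h (u - t) * reDigammaQuarter u)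
        - (2 * h - 1 / Δ) * Real.log (t / 2)| ≤ C := by
  obtain ⟨C, hC, hdig⟩ := exists_abs_reDigammaQuarter_sub_log_half_le
  set C₀ : ℝ := 3 * Real.exp (2 * π) with hC₀
  refine ⟨10 + (6 * C₀ * (C + 5) + 12 * (C + 9)) * ∫ v : ℝ, ((1 + |v|) * Real.sqrt (1 + |v|))⁻¹,
    fun Δ t h hΔ ht hh0 hh ↦ ?_⟩
  have hΔ0 : 0 < Δ := by linarith
  have hab : -h ≤ h := by linarith
  have hst := sqrt_le_div_six ht
  have hint := integral_selbergMinorantReal hΔ0 hab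
  have hm : (2 * h - 1 / Δ) = ∫ v, selbergMinorantReal Δ (-h) h v := by rw [hint]; ring
  rw [hm]
  refine (core (G := fun v ↦ (Icc (-h) h).indicator (fun _ ↦ (1 : ℝ)) v - selbergMinorantReal Δ (-h) h v)
    hC (by positivity : (0 : ℝ) ≤ C₀) hdig
    (continuous_selbergMinorantReal Δ (-h) h) (integrable_selbergMinorantReal hΔ0 hab)
    (fun v ↦ abs_selbergMinorantReal_le hΔ0 _ _ v) ht hh0 hh ?_ ?_
    (integrable_indicator_sub_selbergMinorantReal hΔ0 hab) ?_ ?_).2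
  · intro v
    have h1 := selbergMinorantReal_le_indicator_Icc hΔ0 (-h) h v
    have h0 : 0 ≤ (Icc (-h) h).indicator (fun _ ↦ (1 : ℝ)) v :=
      Set.indicator_nonneg (fun _ _ ↦ zero_le_one) v
    rw [abs_le]; constructor <;> linarith
  · intro v
    have := selbergMinorantReal_le_indicator_Icc hΔ0 (-h) h v
    linarith
  · rw [integral_indicator_sub_selbergMinorantReal hΔ0 hab, div_le_one hΔ0]; exact hΔ
  · intro v hv
    exact abs_selbergMinorantReal_le_far hΔ hh0 (by linarith [hh.trans hst])

end Literature.NumberTheory.LFunctions
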